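import Literature.AlgebraicGeometry.RelativeSpec.SymmetricPowerGlued
import Literature.AlgebraicGeometry.Motives.ProjectiveDescentNormProofs
import HarnessLib

/-!
# Symmetric powers `C⁽ⁿ⁾ = Cⁿ/𝔖ₙ` of projective schemes over a field (Milne, *Jacobian
# Varieties*, §3, Prop. 3.1 and the proof of Prop. 3.2)

Milne, *Jacobian Varieties*, §3, Prop. 3.1: for a (nonsingular) variety `C` over `k` "the quotient
`C^{(r)} = Cʳ/S_r` exists as a variety"; the existence is Mumford's theorem (AV §7, p. 66), whose
hypothesis holds since "any finite set of points of a quasi-projective variety is contained in an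
open affine subset" (proof of Prop. 3.2). This file proves the hypothesis for projective
`k`-schemes and packages the symmetric power as a `k`-scheme with its universal property:

* `IsProjectiveOver.finiteSubsetsInAffineOpens` — for `C ↪ ℙⁿ_k` closed and a finite `T ⊆ C`
  there is a form `F` of positive degree with `T ⊆ C ∩ D₊(F)`, an affine open (the tree's graded
  prime avoidance `GradedPrimeAvoidance.exists_form_basicOpen`, Mathlib
  `Proj.isAffineOpen_basicOpen`);
* `IsProjectiveOver.isSeparated` — projective ⇒ separated over `k` (via the tree's
  `IsProjectiveOver.isProper`);
* `symPowProj C hC n : SchemeOver k` — `C⁽ⁿ⁾` (`= symPowGlued C.hom n` over `k`), with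
  `symPowProj.mk : Cⁿ → C⁽ⁿ⁾` over `k` (`permOver_mk`: symmetric; `mk_surjective`;
  `mk_eq_iff`: fibres are the `𝔖ₙ`-orbits), the **universal property over `k`**
  `symPowProj.existsUnique_descOver` for symmetric `k`-morphisms `Cⁿ → Z`, `Z` separated, and:
  `C⁽ⁿ⁾ → Spec k` is separated and universally closed (`isSeparated_hom`, `isSeparated_left`,
  `universallyClosed_hom`).

Not covered here (later items on Milne's path): `C⁽ⁿ⁾` is of finite type (hence proper) / a variety,
nonsingular for a nonsingular curve (Prop. 3.2), and represents effective divisors of degree `n`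
(Thm. 3.13). Everything is proved; no named facts (D-0026).

## References

* J. S. Milne, *Jacobian Varieties*, in *Arithmetic Geometry* (Storrs 1984), Springer 1986,
  Ch. VII, §3, Prop. 3.1, proof of Prop. 3.2. [Milne1986JacobianVarieties]
* D. Mumford, *Abelian Varieties* (1970), §7, Theorem p. 66, Remark p. 69. [MumfordAV1970]
* B. Singh, *Basic Commutative Algebra* (2011), 2.9.2 (graded prime avoidance). [Singh2011]
-/

noncomputable section

universe u

open CategoryTheory Limits AlgebraicGeometry Literature.AlgebraicGeometry.RelativeSpec

namespace Literature.AlgebraicGeometry.Motives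

variable {k : Type u} [Field k]

/-- **Finite subsets of a projective `k`-scheme lie in affine opens** (graded prime avoidance:
a form `F` of positive degree not vanishing at finitely many given points of `X ⊆ ℙⁿ_k`, and
`X ∩ D₊(F)` is affine). [cite: Milne1986JacobianVarieties, §3, proof of Prop. 3.2 ("any finite set of points of a quasi-projective variety … is contained in an open affine", Mumford 1970, p. 69)] -/
theorem IsProjectiveOver.finiteSubsetsInAffineOpens {C : SchemeOver k} (hC : IsProjectiveOver C) :
    FiniteSubsetsInAffineOpens C.hom := by
  classical
  refine ⟨fun T => ?_⟩
  obtain ⟨n, ι, hι⟩ := hC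
  letI := MvPolynomial.gradedAlgebra (σ := Fin (n + 1)) (R := k)
  let 𝒜 := MvPolynomial.homogeneousSubmodule (Fin (n + 1)) k
  let rr : C.left ⟶ Proj 𝒜 := ι.left
  haveI : IsClosedImmersion rr := hι
  obtain ⟨m, F, hm, hF, hT, -⟩ := GradedPrimeAvoidance.exists_form_basicOpen 𝒜 rr
    rr.isClosedEmbedding.injective rr.isClosedEmbedding.isClosedMap T ⊤ (fun _ _ => trivial)
  refine ⟨rr ⁻¹ᵁ Proj.basicOpen 𝒜 F, ?_, hT⟩
  have hW : IsAffineOpen (rr ⁻¹ᵁ Proj.basicOpen 𝒜 F) :=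
    (Proj.isAffineOpen_basicOpen 𝒜 F hF hm).preimage rr
  haveI : IsAffine (↑(rr ⁻¹ᵁ Proj.basicOpen 𝒜 F) : Scheme.{u}) := hW
  haveI : IsAffine ((Functor.fromPUnit (Spec (.of k))).obj C.right) :=
    inferInstanceAs (IsAffine (Spec (.of k)))
  infer_instance

/-- A projective `k`-scheme is separated over `k`. [folklore] -/
theorem IsProjectiveOver.isSeparated {C : SchemeOver k} (hC : IsProjectiveOver C) :
    IsSeparated C.hom :=
  haveI := hC.isProper
  inferInstance

/-- The base `Spec R` of an `Over (Spec R)`-object is separated (instance in the syntactic form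
in which it occurs as the target of `X.hom`). [folklore] -/
instance isSeparated_fromPUnit_spec (R : CommRingCat.{u}) (P : Discrete PUnit.{1}) :
    ((Functor.fromPUnit.{0} (Spec R)).obj P).IsSeparated :=
  inferInstanceAs ((Spec R).IsSeparated)

/-- **The symmetric power `C⁽ⁿ⁾ = Cⁿ/𝔖ₙ` of a projective scheme over a field** as a scheme with
its quotient map and universal property (Milne JV §3 Prop. 3.1: "the symmetric group `S_r` acts on
`Cʳ` … and the quotient `C^{(r)} = Cʳ/S_r` exists as a variety"; existence by Mumford AV §7
Thm. p. 66, the orbit of a point of `Cʳ` lying in `Wʳ` for `W ⊆ C` an affine open containing its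
coordinates). [cite: Milne1986JacobianVarieties, §3 Prop. 3.1] -/
def symPowProj (C : SchemeOver k) (hC : IsProjectiveOver C) (n : ℕ) : SchemeOver k :=
  Over.mk (@symPowGlued.base _ _ C.hom n _ hC.isSeparated)

/-- The underlying scheme of `C⁽ⁿ⁾` is the glued quotient `Cⁿ/𝔖ₙ`. [folklore] -/
theorem symPowProj_left (C : SchemeOver k) (hC : IsProjectiveOver C) (n : ℕ) :
    (symPowProj C hC n).left = @symPowGlued _ _ C.hom n _ hC.isSeparated := rfl

/-- **`C⁽ⁿ⁾ → Spec k` is separated.** [cite: Milne1986JacobianVarieties, §3 Prop. 3.1] -/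
instance symPowProj.isSeparated_hom (C : SchemeOver k) (hC : IsProjectiveOver C) (n : ℕ) :
    IsSeparated (symPowProj C hC n).hom :=
  haveI := hC.isSeparated
  symPowGlued.isSeparated_base C.hom n hC.finiteSubsetsInAffineOpens

/-- `C⁽ⁿ⁾` is a separated scheme. [folklore] -/
instance symPowProj.isSeparated_left (C : SchemeOver k) (hC : IsProjectiveOver C) (n : ℕ) :
    (symPowProj C hC n).left.IsSeparated :=
  haveI := hC.isSeparated
  symPowGlued.isSeparated C.hom n hC.finiteSubsetsInAffineOpens

/-- **`C⁽ⁿ⁾ → Spec k` is universally closed** (`C` is proper over `k`). [cite: Milne1986JacobianVarieties, §3 Prop. 3.1] -/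
instance symPowProj.universallyClosed_hom (C : SchemeOver k) (hC : IsProjectiveOver C) (n : ℕ) :
    UniversallyClosed (symPowProj C hC n).hom :=
  haveI := hC.isSeparated
  haveI := hC.isProper
  symPowGlued.universallyClosed_base C.hom n hC.finiteSubsetsInAffineOpens

/-- The quotient map `Cⁿ → C⁽ⁿ⁾` over `k`. [cite: Milne1986JacobianVarieties, §3 Prop. 3.1] -/
def symPowProj.mk (C : SchemeOver k) (hC : IsProjectiveOver C) (n : ℕ) :
    powOverObj C.hom n ⟶ symPowProj C hC n :=
  haveI := hC.isSeparated
  Over.homMk (symPowGlued.mk C.hom n hC.finiteSubsetsInAffineOpens)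
    (symPowGlued.mk_base C.hom n _)

/-- `mk` is symmetric. [cite: Milne1986JacobianVarieties, §3 Prop. 3.1] -/
@[reassoc]
theorem symPowProj.permOver_mk (C : SchemeOver k) (hC : IsProjectiveOver C) (n : ℕ)
    (σ : Equiv.Perm (Fin n)) : permOver C.hom n σ ≫ symPowProj.mk C hC n = symPowProj.mk C hC n := by
  haveI := hC.isSeparated
  ext : 1
  exact permHom_symPowGlued_mk C.hom n hC.finiteSubsetsInAffineOpens σ

/-- The fibres of `mk` are the `𝔖ₙ`-orbits. [cite: Milne1986JacobianVarieties, §3 Prop. 3.1] -/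
theorem symPowProj.mk_eq_iff (C : SchemeOver k) (hC : IsProjectiveOver C) (n : ℕ)
    (x y : powOver C.hom n) :
    (symPowProj.mk C hC n).left x = (symPowProj.mk C hC n).left y ↔
      ∃ σ : Equiv.Perm (Fin n), permHom C.hom n σ x = y :=
  haveI := hC.isSeparated
  symPowGlued.mk_eq_iff C.hom n hC.finiteSubsetsInAffineOpens x y

/-- `mk` is surjective. [cite: Milne1986JacobianVarieties, §3 Prop. 3.1] -/
theorem symPowProj.mk_surjective (C : SchemeOver k) (hC : IsProjectiveOver C) (n : ℕ) :
    Function.Surjective (symPowProj.mk C hC n).left :=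
  haveI := hC.isSeparated
  symPowGlued.mk_surjective C.hom n hC.finiteSubsetsInAffineOpens

set_option backward.isDefEq.respectTransparency false in
/-- **Universal property of `C⁽ⁿ⁾` over `k`**: symmetric `k`-morphisms `Cⁿ → Z` (with `Z`
separated) factor uniquely through `mk`. [cite: Milne1986JacobianVarieties, §3 Prop. 3.1] -/
theorem symPowProj.existsUnique_descOver (C : SchemeOver k) (hC : IsProjectiveOver C) (n : ℕ)
    {Z : SchemeOver k} [Z.left.IsSeparated] (f : powOverObj C.hom n ⟶ Z)
    (hf : ∀ σ : Equiv.Perm (Fin n), permOver C.hom n σ ≫ f = f) :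
    ∃! fbar : symPowProj C hC n ⟶ Z, symPowProj.mk C hC n ≫ fbar = f := by
  haveI := hC.isSeparated
  have hX := hC.finiteSubsetsInAffineOpens
  have hf' : ∀ σ : Equiv.Perm (Fin n), permHom C.hom n σ ≫ f.left = f.left := fun σ =>
    congrArg CommaMorphism.left (hf σ)
  obtain ⟨g, hg, huniq⟩ := symPowGlued.existsUnique_desc C.hom n hX f.left hf'
  have hw : g ≫ Z.hom = (symPowProj C hC n).hom := by
    apply symPowGlued.hom_ext C.hom n hX
    have e1 : symPowGlued.mk C.hom n hX ≫ g ≫ Z.hom = f.left ≫ Z.hom := by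
      rw [← Category.assoc, hg]
    have e2 : f.left ≫ Z.hom = powOver.base C.hom n := Over.w f
    exact (e1.trans e2).trans (symPowGlued.mk_base C.hom n hX).symm
  refine ⟨Over.homMk g hw, ?_, ?_⟩
  · ext : 1
    exact hg
  · intro g' hg'
    ext : 1
    exact huniq _ (congrArg CommaMorphism.left hg')

end Literature.AlgebraicGeometry.Motives

end
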